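import Summits.Parity.GeneralizedHardyLittlewood.Theorems.GreenTaoLevelTwoMNTwoCentralTranslation
import Summits.Parity.GeneralizedHardyLittlewood.Theorems.GreenTaoLevelTwoGITwoCyclicInverseHeisenbergBracket
import Summits.Parity.GeneralizedHardyLittlewood.Theorems.GreenTaoLevelTwoMNTwoTorusPartition

/-!
# Route `GreenTaoLevelTwo`, crux `MNTwo` (stmt-Parity-21276), line `birth`, stub `stub_mnVertical`:
# GT 2008b App. A (Prop. 5) for the Heisenberg group — the bracket section and its local quadraticity

Block V7 of the `stub_mnVertical` census (B. Green, T. Tao, *Quadratic uniformity of the Möbius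
function*, Ann. Inst. Fourier 58 (2008) = arXiv:math/0606087, App. A, Prop. 5 "2-step nilsequences
as averages of twisted 1-step nilsequences", in the explicit Heisenberg coordinates the source uses:
"This approach is completely explicit when the group `G` is a product of Heisenberg groups").

For `H³(ℝ) ∋ w = (a, b, c)` (law `(x,y,z)(x',y',z') = (x+x', y+y', z+z'+xy')`, lattice `H³(ℤ)`)
and one of the four quarter-tents `τ_j(b) = max(0, 1 − 4‖b − j/4‖_{ℝ/ℤ})` (`j < 4`, the
partition of unity of `…MNTwoTorusPartition` with `m = 4`) we use the CONTINUOUS `1`-periodic lift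
`λ_j(b) = j/4 + 5/4 − ‖b − j/4 − 1/4‖_{ℝ/ℤ}` of the second coordinate, which on the support of
`τ_j` differs from `b` by an INTEGER `k` and lies in the open interval `(j/4 + 3/4, j/4 + 5/4)` of
length `1/2` (`exists_int_sub_lift_of_tent_ne_zero`).  Consequences (def-free):

* `bracket_decomposition` — on `supp τ_j`: `w = (0,0,c − a k) · (a, λ_j(b), 0) · (0, k, 0)` with
  `(0,0,c − ak)` CENTRAL and `(0,k,0) ∈ H³(ℤ)`;
* `lift_parallelogram` — along an affine sequence `b_v`, the integer parts `b_v − λ_j(b_v)` have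
  vanishing second differences on parallelograms inside the support (integer of modulus `< 1`);
* `bracket_cube` — for `w_v = g^v x₀` (`v ∈ ℤ`), the central parts `c_v − a_v k_v` have vanishing
  THIRD differences on every `3`-cube inside the support: the phase of the vertical character is
  locally quadratic there (the heart of Prop. 5: "`φ_i` is locally quadratic on `B_i`");
* `lift_periodic`, `abs_lift_sub_lift_le`, `lift_mem_Icc` — periodicity / `1`-Lipschitz / range of `λ_j`.

References: [GreenTao2008QuadraticMobius] arXiv:math/0606087, App. A (Prop. 5, Heisenberg case).
-/

noncomputable section

open Literature.NumberTheory.Sieve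
open Literature.NumberTheory.Sieve.GreenTaoLevelTwo (HX boxGauge heisPreDist)
open Summit.Parity.GeneralizedHardyLittlewood.GreenTaoLevelTwoMNTwoCentralTranslation
open Summit.Parity.GeneralizedHardyLittlewood.GreenTaoLevelTwoGITwoCyclicInverse (heis_zpow coe_add_int_eq)

namespace Summit.Parity.GeneralizedHardyLittlewood.GreenTaoLevelTwoMNTwoBracketHeis

/-! ### §1 The continuous periodic lift `λ_j` of the second coordinate -/

/-- `λ_j` is `1`-periodic (integer shifts). [folklore] -/
theorem lift_periodic (j : ℕ) (b : ℝ) (k : ℤ) :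
    (j : ℝ) / 4 + 5 / 4 - ‖((b + k - (j : ℝ) / 4 - 1 / 4 : ℝ) : AddCircle (1 : ℝ))‖ =
      (j : ℝ) / 4 + 5 / 4 - ‖((b - (j : ℝ) / 4 - 1 / 4 : ℝ) : AddCircle (1 : ℝ))‖ := by
  rw [show (b + k - (j : ℝ) / 4 - 1 / 4 : ℝ) = (b - (j : ℝ) / 4 - 1 / 4) + k by ring, coe_add_int_eq]

/-- `λ_j` is `1`-Lipschitz. [folklore] -/
theorem abs_lift_sub_lift_le (j : ℕ) (b b' : ℝ) :
    |((j : ℝ) / 4 + 5 / 4 - ‖((b - (j : ℝ) / 4 - 1 / 4 : ℝ) : AddCircle (1 : ℝ))‖) -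
        ((j : ℝ) / 4 + 5 / 4 - ‖((b' - (j : ℝ) / 4 - 1 / 4 : ℝ) : AddCircle (1 : ℝ))‖)| ≤
      |b - b'| := by
  rw [show ((j : ℝ) / 4 + 5 / 4 - ‖((b - (j : ℝ) / 4 - 1 / 4 : ℝ) : AddCircle (1 : ℝ))‖) -
        ((j : ℝ) / 4 + 5 / 4 - ‖((b' - (j : ℝ) / 4 - 1 / 4 : ℝ) : AddCircle (1 : ℝ))‖) =
      -(‖((b - (j : ℝ) / 4 - 1 / 4 : ℝ) : AddCircle (1 : ℝ))‖ -
        ‖((b' - (j : ℝ) / 4 - 1 / 4 : ℝ) : AddCircle (1 : ℝ))‖) by ring, abs_neg]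
  refine (abs_norm_sub_norm_le _ _).trans ?_
  rw [← AddCircle.coe_sub, show (b - (j : ℝ) / 4 - 1 / 4 - (b' - (j : ℝ) / 4 - 1 / 4) : ℝ) = b - b'
    by ring]
  exact GreenTaoLevelTwoMNTwoRotationBohrSize.norm_coe_le_abs' _

/-- `λ_j(b) ∈ [j/4 + 3/4, j/4 + 5/4]`. [folklore] -/
theorem lift_mem_Icc (j : ℕ) (b : ℝ) :
    (j : ℝ) / 4 + 3 / 4 ≤ (j : ℝ) / 4 + 5 / 4 - ‖((b - (j : ℝ) / 4 - 1 / 4 : ℝ) : AddCircle (1 : ℝ))‖ ∧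
      (j : ℝ) / 4 + 5 / 4 - ‖((b - (j : ℝ) / 4 - 1 / 4 : ℝ) : AddCircle (1 : ℝ))‖ ≤ (j : ℝ) / 4 + 5 / 4 := by
  have h0 : 0 ≤ ‖((b - (j : ℝ) / 4 - 1 / 4 : ℝ) : AddCircle (1 : ℝ))‖ := norm_nonneg _
  have h1 : ‖((b - (j : ℝ) / 4 - 1 / 4 : ℝ) : AddCircle (1 : ℝ))‖ ≤ 1 / 2 := by
    have := AddCircle.norm_le_half_period (1 : ℝ) (x := ((b - (j : ℝ) / 4 - 1 / 4 : ℝ) :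
      AddCircle (1 : ℝ))) one_ne_zero
    simpa using this
  constructor <;> linarith

/-- The support of the quarter-tent `τ_j`: `τ_j(b) ≠ 0 ⇒ ‖b − j/4‖_{ℝ/ℤ} < 1/4`. [folklore] -/
theorem norm_lt_quarter_of_tent_ne_zero {j : ℕ} {b : ℝ}
    (hb : max 0 (1 - (4 : ℝ) * ‖((b - (j : ℝ) / 4 : ℝ) : AddCircle (1 : ℝ))‖) ≠ 0) :
    ‖((b - (j : ℝ) / 4 : ℝ) : AddCircle (1 : ℝ))‖ < 1 / 4 := by
  by_contra hcon
  push Not at hcon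
  exact hb (max_eq_left (by linarith))

/-- **On the support of `τ_j` the lift differs from `b` by an integer and lies in the open middle
half**: `τ_j(b) ≠ 0 ⇒ ∃ k ∈ ℤ, b − λ_j(b) = k` and `|λ_j(b) − (j/4 + 1)| < 1/4`.
[cite: GreenTao2008QuadraticMobius, App. A (proof of Prop. 5: choice of coordinates on the support of a bump)] -/
theorem exists_int_sub_lift_of_tent_ne_zero {j : ℕ} {b : ℝ}
    (hb : max 0 (1 - (4 : ℝ) * ‖((b - (j : ℝ) / 4 : ℝ) : AddCircle (1 : ℝ))‖) ≠ 0) :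
    ∃ k : ℤ, b - ((j : ℝ) / 4 + 5 / 4 - ‖((b - (j : ℝ) / 4 - 1 / 4 : ℝ) : AddCircle (1 : ℝ))‖) = k ∧
      |((j : ℝ) / 4 + 5 / 4 - ‖((b - (j : ℝ) / 4 - 1 / 4 : ℝ) : AddCircle (1 : ℝ))‖) -
          ((j : ℝ) / 4 + 1)| < 1 / 4 := by
  have hlt := norm_lt_quarter_of_tent_ne_zero hb
  rw [AddCircle.norm_eq] at hlt
  simp only [inv_one, one_mul, mul_one] at hlt
  set r : ℤ := round (b - (j : ℝ) / 4) with hr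
  set s : ℝ := b - (j : ℝ) / 4 - r with hs
  have hs4 : |s| < 1 / 4 := hlt
  have hkey : ‖((b - (j : ℝ) / 4 - 1 / 4 : ℝ) : AddCircle (1 : ℝ))‖ = 1 / 4 - s := by
    rw [show (b - (j : ℝ) / 4 - 1 / 4 : ℝ) = (s - 1 / 4) + r by rw [hs]; ring, coe_add_int_eq,
      (AddCircle.norm_coe_eq_abs_iff (p := (1 : ℝ)) one_ne_zero).mpr]
    · rw [abs_of_nonpos] <;> [ring; (have := (abs_lt.mp hs4).2; linarith)]
    · rw [abs_one, abs_le]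
      obtain ⟨h1, h2⟩ := abs_lt.mp hs4
      constructor <;> linarith
  refine ⟨r - 1, ?_, ?_⟩
  · rw [hkey]; push_cast; rw [hs]; ring
  · rw [hkey, show (j : ℝ) / 4 + 5 / 4 - (1 / 4 - s) - ((j : ℝ) / 4 + 1) = s by ring]
    exact hs4

/-! ### §2 The bracket decomposition of a Heisenberg element -/

/-- **Bracket decomposition**: on the support of `τ_j`,
`(a,b,c) = (0,0,c − a k) · (a, λ_j(b), 0) · (0,k,0)` with `k = b − λ_j(b) ∈ ℤ`, the first factor
central and the last in `H³(ℤ)`.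
[cite: GreenTao2008QuadraticMobius, App. A, Prop. 5 (Mal'cev coordinates in the Heisenberg case)] -/
theorem bracket_decomposition (j : ℕ) (w : Heis)
    (hw : max 0 (1 - (4 : ℝ) * ‖((w.y - (j : ℝ) / 4 : ℝ) : AddCircle (1 : ℝ))‖) ≠ 0) :
    ∃ γ ∈ Heis.latticeΓ,
      w = Heis.mk 0 0 (w.z - w.x * (w.y -
              ((j : ℝ) / 4 + 5 / 4 - ‖((w.y - (j : ℝ) / 4 - 1 / 4 : ℝ) : AddCircle (1 : ℝ))‖))) *
            Heis.mk w.x ((j : ℝ) / 4 + 5 / 4 - ‖((w.y - (j : ℝ) / 4 - 1 / 4 : ℝ) : AddCircle (1 : ℝ))‖) 0 *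
          γ := by
  obtain ⟨k, hk, -⟩ := exists_int_sub_lift_of_tent_ne_zero hw
  refine ⟨Heis.mk 0 k 0, ?_, ?_⟩
  · have := Heis.mk_int_mem 0 k 0
    simpa using this
  · rw [hk]
    apply Heis.ext
    · simp
    · simp only [Heis.y_mul, Heis.y_mk]
      have := hk; linarith
    · simp only [Heis.z_mul, Heis.x_mul, Heis.z_mk, Heis.x_mk, Heis.y_mk]
      ring

/-! ### §3 Local linearity of the integer part, local quadraticity of the central part -/

/-- **Parallelogram lemma**: if `b₁ − b₂ − b₃ + b₄ = 0` and all four points lie in the support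
of `τ_j`, then the integer parts `kᵢ = bᵢ − λ_j(bᵢ)` satisfy `k₁ − k₂ − k₃ + k₄ = 0` (an integer
of modulus `< 1`). [cite: GreenTao2008QuadraticMobius, App. A, Prop. 5 (local linearity of the bracket)] -/
theorem lift_parallelogram (j : ℕ) {b₁ b₂ b₃ b₄ : ℝ} (hsum : b₁ - b₂ - b₃ + b₄ = 0)
    (h₁ : max 0 (1 - (4 : ℝ) * ‖((b₁ - (j : ℝ) / 4 : ℝ) : AddCircle (1 : ℝ))‖) ≠ 0)
    (h₂ : max 0 (1 - (4 : ℝ) * ‖((b₂ - (j : ℝ) / 4 : ℝ) : AddCircle (1 : ℝ))‖) ≠ 0)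
    (h₃ : max 0 (1 - (4 : ℝ) * ‖((b₃ - (j : ℝ) / 4 : ℝ) : AddCircle (1 : ℝ))‖) ≠ 0)
    (h₄ : max 0 (1 - (4 : ℝ) * ‖((b₄ - (j : ℝ) / 4 : ℝ) : AddCircle (1 : ℝ))‖) ≠ 0) :
    (b₁ - ((j : ℝ) / 4 + 5 / 4 - ‖((b₁ - (j : ℝ) / 4 - 1 / 4 : ℝ) : AddCircle (1 : ℝ))‖)) -
      (b₂ - ((j : ℝ) / 4 + 5 / 4 - ‖((b₂ - (j : ℝ) / 4 - 1 / 4 : ℝ) : AddCircle (1 : ℝ))‖)) -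
      (b₃ - ((j : ℝ) / 4 + 5 / 4 - ‖((b₃ - (j : ℝ) / 4 - 1 / 4 : ℝ) : AddCircle (1 : ℝ))‖)) +
      (b₄ - ((j : ℝ) / 4 + 5 / 4 - ‖((b₄ - (j : ℝ) / 4 - 1 / 4 : ℝ) : AddCircle (1 : ℝ))‖)) = 0 := by
  obtain ⟨k₁, hk₁, hs₁⟩ := exists_int_sub_lift_of_tent_ne_zero h₁
  obtain ⟨k₂, hk₂, hs₂⟩ := exists_int_sub_lift_of_tent_ne_zero h₂
  obtain ⟨k₃, hk₃, hs₃⟩ := exists_int_sub_lift_of_tent_ne_zero h₃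
  obtain ⟨k₄, hk₄, hs₄⟩ := exists_int_sub_lift_of_tent_ne_zero h₄
  rw [hk₁, hk₂, hk₃, hk₄]
  -- the integer `k₁ − k₂ − k₃ + k₄` has modulus `< 1`
  have hint : |((k₁ - k₂ - k₃ + k₄ : ℤ) : ℝ)| < 1 := by
    push_cast
    rw [← hk₁, ← hk₂, ← hk₃, ← hk₄]
    rw [abs_lt] at hs₁ hs₂ hs₃ hs₄ ⊢
    obtain ⟨a₁, c₁⟩ := hs₁
    obtain ⟨a₂, c₂⟩ := hs₂
    obtain ⟨a₃, c₃⟩ := hs₃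
    obtain ⟨a₄, c₄⟩ := hs₄
    constructor <;> linarith
  have hz : (k₁ - k₂ - k₃ + k₄ : ℤ) = 0 := by
    rw [← Int.cast_abs, ← Int.cast_one, Int.cast_lt, Int.abs_lt_one_iff] at hint
    exact hint
  exact_mod_cast hz

/-- Integer powers times a base point, in coordinates: for `g = (α, β, γ)` and `x₀ = (a, b, c)`,
`g^v x₀ = (vα + a, vβ + b, vγ + v(v−1)/2·αβ + c + vα b)`. [cite: GreenTao2010, §11, Example after Prop. 11.5] -/
theorem zpow_mul_coords (g x₀ : Heis) (v : ℤ) :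
    (g ^ v * x₀).x = v * g.x + x₀.x ∧ (g ^ v * x₀).y = v * g.y + x₀.y ∧
      (g ^ v * x₀).z = v * g.z + ((v : ℝ) * (v - 1) / 2) * (g.x * g.y) + x₀.z + v * g.x * x₀.y := by
  obtain ⟨hx, hy, hz⟩ := heis_zpow g v
  refine ⟨by rw [Heis.x_mul, hx], by rw [Heis.y_mul, hy], by rw [Heis.z_mul, hz, hx]⟩

/-- **Local quadraticity of the central part on `3`-cubes (the bracket phase is locally
quadratic on the support of the bump).**  For `w_v = g^v x₀ = (a_v, b_v, c_v)` and the central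
parts `t_v = c_v − a_v (b_v − λ_j(b_v))`: if the eight vertices `v = n + e₁h₁ + e₂h₂ + e₃h₃` of a
`3`-cube all lie in the support of `τ_j(b_v)`, the alternating product of the `(0,0,t_v)` is `1`.
[cite: GreenTao2008QuadraticMobius, App. A, Prop. 5 ("`φ_i` is locally quadratic on `B_i`")] -/
theorem bracket_cube (j : ℕ) (g x₀ : Heis) (n h₁ h₂ h₃ : ℤ)
    (hsupp : ∀ e₁ e₂ e₃ : ℕ, e₁ ≤ 1 → e₂ ≤ 1 → e₃ ≤ 1 →
      max 0 (1 - (4 : ℝ) * ‖(((g ^ (n + e₁ * h₁ + e₂ * h₂ + e₃ * h₃) * x₀).y - (j : ℝ) / 4 : ℝ) :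
        AddCircle (1 : ℝ))‖) ≠ 0) :
    (fun w : Heis => Heis.mk 0 0 (w.z - w.x * (w.y -
        ((j : ℝ) / 4 + 5 / 4 - ‖((w.y - (j : ℝ) / 4 - 1 / 4 : ℝ) : AddCircle (1 : ℝ))‖))))
        (g ^ (n + h₁ + h₂ + h₃) * x₀) *
      ((fun w : Heis => Heis.mk 0 0 (w.z - w.x * (w.y -
        ((j : ℝ) / 4 + 5 / 4 - ‖((w.y - (j : ℝ) / 4 - 1 / 4 : ℝ) : AddCircle (1 : ℝ))‖))))
        (g ^ (n + h₁ + h₂) * x₀))⁻¹ *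
      ((fun w : Heis => Heis.mk 0 0 (w.z - w.x * (w.y -
        ((j : ℝ) / 4 + 5 / 4 - ‖((w.y - (j : ℝ) / 4 - 1 / 4 : ℝ) : AddCircle (1 : ℝ))‖))))
        (g ^ (n + h₁ + h₃) * x₀))⁻¹ *
      ((fun w : Heis => Heis.mk 0 0 (w.z - w.x * (w.y -
        ((j : ℝ) / 4 + 5 / 4 - ‖((w.y - (j : ℝ) / 4 - 1 / 4 : ℝ) : AddCircle (1 : ℝ))‖))))
        (g ^ (n + h₂ + h₃) * x₀))⁻¹ *
      (fun w : Heis => Heis.mk 0 0 (w.z - w.x * (w.y -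
        ((j : ℝ) / 4 + 5 / 4 - ‖((w.y - (j : ℝ) / 4 - 1 / 4 : ℝ) : AddCircle (1 : ℝ))‖))))
        (g ^ (n + h₁) * x₀) *
      (fun w : Heis => Heis.mk 0 0 (w.z - w.x * (w.y -
        ((j : ℝ) / 4 + 5 / 4 - ‖((w.y - (j : ℝ) / 4 - 1 / 4 : ℝ) : AddCircle (1 : ℝ))‖))))
        (g ^ (n + h₂) * x₀) *
      (fun w : Heis => Heis.mk 0 0 (w.z - w.x * (w.y -
        ((j : ℝ) / 4 + 5 / 4 - ‖((w.y - (j : ℝ) / 4 - 1 / 4 : ℝ) : AddCircle (1 : ℝ))‖))))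
        (g ^ (n + h₃) * x₀) *
      ((fun w : Heis => Heis.mk 0 0 (w.z - w.x * (w.y -
        ((j : ℝ) / 4 + 5 / 4 - ‖((w.y - (j : ℝ) / 4 - 1 / 4 : ℝ) : AddCircle (1 : ℝ))‖))))
        (g ^ n * x₀))⁻¹ = 1 := by
  -- abbreviate the lift along the orbit
  set Λ : ℝ → ℝ := fun b => (j : ℝ) / 4 + 5 / 4 - ‖((b - (j : ℝ) / 4 - 1 / 4 : ℝ) : AddCircle (1 : ℝ))‖
    with hΛ
  simp only [mk_zero_zero_inv, ← mk_zero_zero_add, ← mk_zero_zero_zero]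
  congr 1
  -- coordinates of the eight vertices
  have hc := fun v : ℤ => zpow_mul_coords g x₀ v
  -- supports of the eight vertices
  have s000 := hsupp 0 0 0 (by norm_num) (by norm_num) (by norm_num)
  have s100 := hsupp 1 0 0 (by norm_num) (by norm_num) (by norm_num)
  have s010 := hsupp 0 1 0 (by norm_num) (by norm_num) (by norm_num)
  have s001 := hsupp 0 0 1 (by norm_num) (by norm_num) (by norm_num)
  have s110 := hsupp 1 1 0 (by norm_num) (by norm_num) (by norm_num)
  have s101 := hsupp 1 0 1 (by norm_num) (by norm_num) (by norm_num)
  have s011 := hsupp 0 1 1 (by norm_num) (by norm_num) (by norm_num)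
  have s111 := hsupp 1 1 1 (by norm_num) (by norm_num) (by norm_num)
  simp only [Nat.cast_zero, Nat.cast_one, zero_mul, one_mul, add_zero]
    at s000 s100 s010 s001 s110 s101 s011 s111
  -- the `y`-coordinates are affine in `v`
  have hy : ∀ v : ℤ, (g ^ v * x₀).y = v * g.y + x₀.y := fun v => (hc v).2.1
  -- four parallelograms: (n; h₁,h₂), (n; h₁,h₃), (n; h₂,h₃), (n+h₁; h₂,h₃)
  have P12 := lift_parallelogram j (b₁ := (g ^ (n + h₁ + h₂) * x₀).y) (b₂ := (g ^ (n + h₁) * x₀).y)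
    (b₃ := (g ^ (n + h₂) * x₀).y) (b₄ := (g ^ n * x₀).y)
    (by rw [hy, hy, hy, hy]; push_cast; ring) s110 s100 s010 s000
  have P13 := lift_parallelogram j (b₁ := (g ^ (n + h₁ + h₃) * x₀).y) (b₂ := (g ^ (n + h₁) * x₀).y)
    (b₃ := (g ^ (n + h₃) * x₀).y) (b₄ := (g ^ n * x₀).y)
    (by rw [hy, hy, hy, hy]; push_cast; ring) s101 s100 s001 s000
  have P23 := lift_parallelogram j (b₁ := (g ^ (n + h₂ + h₃) * x₀).y) (b₂ := (g ^ (n + h₂) * x₀).y)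
    (b₃ := (g ^ (n + h₃) * x₀).y) (b₄ := (g ^ n * x₀).y)
    (by rw [hy, hy, hy, hy]; push_cast; ring) s011 s010 s001 s000
  have P123 := lift_parallelogram j (b₁ := (g ^ (n + h₁ + h₂ + h₃) * x₀).y)
    (b₂ := (g ^ (n + h₁ + h₂) * x₀).y) (b₃ := (g ^ (n + h₁ + h₃) * x₀).y)
    (b₄ := (g ^ (n + h₁) * x₀).y)
    (by rw [hy, hy, hy, hy]; push_cast; ring) s111 s110 s101 s100
  -- name the eight integer parts
  set l000 := (g ^ n * x₀).y - Λ ((g ^ n * x₀).y) with hl000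
  set l100 := (g ^ (n + h₁) * x₀).y - Λ ((g ^ (n + h₁) * x₀).y) with hl100
  set l010 := (g ^ (n + h₂) * x₀).y - Λ ((g ^ (n + h₂) * x₀).y) with hl010
  set l001 := (g ^ (n + h₃) * x₀).y - Λ ((g ^ (n + h₃) * x₀).y) with hl001
  set l110 := (g ^ (n + h₁ + h₂) * x₀).y - Λ ((g ^ (n + h₁ + h₂) * x₀).y) with hl110
  set l101 := (g ^ (n + h₁ + h₃) * x₀).y - Λ ((g ^ (n + h₁ + h₃) * x₀).y) with hl101
  set l011 := (g ^ (n + h₂ + h₃) * x₀).y - Λ ((g ^ (n + h₂ + h₃) * x₀).y) with hl011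
  set l111 := (g ^ (n + h₁ + h₂ + h₃) * x₀).y - Λ ((g ^ (n + h₁ + h₂ + h₃) * x₀).y) with hl111
  change l110 - l100 - l010 + l000 = 0 at P12
  change l101 - l100 - l001 + l000 = 0 at P13
  change l011 - l010 - l001 + l000 = 0 at P23
  change l111 - l110 - l101 + l100 = 0 at P123
  -- the `x`- and `z`-coordinates are polynomial in `v`
  have hx : ∀ v : ℤ, (g ^ v * x₀).x = v * g.x + x₀.x := fun v => (hc v).1
  have hz : ∀ v : ℤ, (g ^ v * x₀).z =
      v * g.z + ((v : ℝ) * (v - 1) / 2) * (g.x * g.y) + x₀.z + v * g.x * x₀.y := fun v => (hc v).2.2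
  rw [hx, hx, hx, hx, hx, hx, hx, hx, hz, hz, hz, hz, hz, hz, hz, hz]
  have e110 : l110 = l100 + l010 - l000 := by linarith
  have e101 : l101 = l100 + l001 - l000 := by linarith
  have e011 : l011 = l010 + l001 - l000 := by linarith
  have e111 : l111 = l100 + l010 + l001 - 2 * l000 := by linarith
  rw [e110, e101, e011, e111]
  push_cast
  ring

end Summit.Parity.GeneralizedHardyLittlewood.GreenTaoLevelTwoMNTwoBracketHeis
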